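import Mathlib
import HarnessLib
import Literature.MathematicalPhysics.KineticTheory.VelocityFlipNoise

/-!
# The flip sector gap: a hypercube Poincaré inequality for flip-invariant measures
(stub `stub_flipSectorGap` of line `abel-kapitza-even-corrector`, crux `VanishingNoiseTransfer.NoisyFourier`,
item stmt-AtomisticToContinuum-11977)

Let `μ` be ANY measure on `PhaseSpace L = ℝ^L × ℝ^L` invariant under every single-site momentum flip
`θ_i = momentumFlip i` (`(q, p) ↦ (q, p[i ↦ -p_i])`, Bernardin–Olla's `ω ↦ ω^i`, J. Stat. Phys. 145 (2011), §2.1),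
and let `P₀ u = 2^{-L} ∑_{w ∈ {0,1}^L} u ∘ σ_w` be the average of `u` over the `2^L` momentum sign patterns
`σ_w (q, p) = (q, (± p_i)_i)`. Then `4 ∫ (u - P₀ u)² dμ ≤ ∑_i ∫ (u ∘ θ_i - u)² dμ` for every `u ∈ L²(μ)`
(`stub_flipSectorGap`; the constant `4` is sharp: equality for `u` odd in exactly one momentum).

Proof (Efron–Stein telescoping, no sector decomposition). Abstract part (any measurable space, any measure,
a sequence `θ₀, θ₁, …` of pairwise commuting `μ`-preserving involutions, `u ∈ L²(μ)`): the iterated averages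
`F₀ = u`, `F_{k+1} = (F_k + F_k ∘ θ_k)/2` satisfy `4 ∫ (u - F_n)² ≤ ∑_{k<n} ∫ (u ∘ θ_k - u)²` (`flipAvg_gap`):
`u - F_{n+1} = (u - F_n) + D_n` with `D_n = (F_n - F_n ∘ θ_n)/2` `θ_k`-even for `k < n` (`flipAvg_even`) while
`u - F_n` is `L²`-orthogonal to every such function (`flipAvg_orth`: the increments `D_k` are `θ_k`-odd), so
`∫ (u - F_{n+1})² = ∫ (u - F_n)² + ∫ D_n²`; and `4 ∫ D_n² = ∫ (F_n - F_n ∘ θ_n)² ≤ ∫ (u - u ∘ θ_n)²` because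
`k ↦ F_k - F_k ∘ θ_n` is the same scheme started from `u - u ∘ θ_n` (`flipAvg_sub_comp`) and each averaging
step is an `L²` contraction (`flipAvg_integral_sq_le`). Concrete part: with `θ_k = momentumFlip k` for `k < L`
(`id` beyond; `exists_natFlip`) the `L`-th iterate is the pattern average `F_L = P₀ u` (`flipAvg_closed_form`,
via the reindexing `w ↦ w[k ↦ ¬ w_k]` of `{0,1}^L`, `sum_pattern_succ`). References: folklore (Fourier–Walsh
analysis on `ℤ₂^L`, the Efron–Stein inequality).
-/

noncomputable section

open MeasureTheory Filter Topology
open scoped BigOperators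
open Literature.MathematicalPhysics.KineticTheory.HeatConduction

namespace Summit.AtomisticToContinuum.FouriersLaw.Cruxes.NoisyFourier.AbelKapitzaEvenCorrector

section Abstract

variable {X : Type*} [MeasurableSpace X] {μ : Measure X} {θ : ℕ → X → X} {u : X → ℝ} {F : ℕ → X → ℝ}

/-- An involutive measurable self-map is a measurable embedding (it is a measurable equivalence, its own
inverse). [folklore] -/
theorem measurableEmbedding_of_involutive {τ : X → X} (hτ : Function.Involutive τ) (hm : Measurable τ) :
    MeasurableEmbedding τ :=
  (⟨⟨τ, τ, hτ, hτ⟩, hm, hm⟩ : X ≃ᵐ X).measurableEmbedding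

/-- Change of variables under a `μ`-preserving involution: `∫ g ∘ τ dμ = ∫ g dμ` (no integrability needed).
[folklore] -/
theorem integral_comp_of_involutive {τ : X → X} (hτμ : MeasurePreserving τ μ μ)
    (hτ : Function.Involutive τ) (g : X → ℝ) : ∫ x, g (τ x) ∂μ = ∫ x, g x ∂μ :=
  hτμ.integral_comp (measurableEmbedding_of_involutive hτ hτμ.measurable) g

omit [MeasurableSpace X] in
/-- The iterated averages `F_{k+1} = (F_k + F_k ∘ θ_k)/2` of commuting involutions are `θ_k`-even for every
`k` already averaged over: `F_n ∘ θ_k = F_n` for `k < n`. [folklore] -/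
theorem flipAvg_even (hθi : ∀ k, Function.Involutive (θ k)) (hθc : ∀ j k x, θ j (θ k x) = θ k (θ j x))
    (hFs : ∀ k x, F (k + 1) x = (F k x + F k (θ k x)) / 2) :
    ∀ n k, k < n → ∀ x, F n (θ k x) = F n x := by
  intro n
  induction n with
  | zero => intro k hk; exact absurd hk (Nat.not_lt_zero k)
  | succ n ih =>
    intro k hk x
    rcases Nat.lt_or_ge k n with hlt | hge
    · rw [hFs n (θ k x), hFs n x, ih k hlt x, hθc n k x, ih k hlt (θ n x)]
    · obtain rfl : k = n := by omega
      rw [hFs k (θ k x), hFs k x, hθi k x, add_comm]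

omit [MeasurableSpace X] in
/-- Along a map `τ` commuting with the `θ_k`, the differences `F_k - F_k ∘ τ` obey the same averaging
recursion. [folklore] -/
theorem flipAvg_sub_comp {τ : X → X} (hτc : ∀ k x, θ k (τ x) = τ (θ k x))
    (hFs : ∀ k x, F (k + 1) x = (F k x + F k (θ k x)) / 2) :
    ∀ k x, F (k + 1) x - F (k + 1) (τ x) =
      ((F k x - F k (τ x)) + (F k (θ k x) - F k (τ (θ k x)))) / 2 := by
  intro k x
  rw [hFs k x, hFs k (τ x), hτc k x]
  ring

/-- The iterated averages of an `L²` function under measure-preserving maps stay in `L²`. [folklore] -/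
theorem flipAvg_memLp (hθμ : ∀ k, MeasurePreserving (θ k) μ μ) (hu : MemLp u 2 μ)
    (hF0 : ∀ x, F 0 x = u x) (hFs : ∀ k x, F (k + 1) x = (F k x + F k (θ k x)) / 2) :
    ∀ n, MemLp (F n) 2 μ := by
  intro n
  induction n with
  | zero => exact hu.ae_eq (ae_of_all _ fun x => (hF0 x).symm)
  | succ n ih =>
    have h := (ih.add (ih.comp_measurePreserving (hθμ n))).mul_const (2⁻¹ : ℝ)
    refine h.ae_eq (ae_of_all _ fun x => ?_)
    simp only [Pi.add_apply, Function.comp_apply, hFs n x, div_eq_mul_inv]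

/-- Each averaging step is an `L²(μ)` contraction: `∫ F_n² dμ ≤ ∫ u² dμ`. [folklore] -/
theorem flipAvg_integral_sq_le (hθμ : ∀ k, MeasurePreserving (θ k) μ μ)
    (hθi : ∀ k, Function.Involutive (θ k)) (hu : MemLp u 2 μ)
    (hF0 : ∀ x, F 0 x = u x) (hFs : ∀ k x, F (k + 1) x = (F k x + F k (θ k x)) / 2) :
    ∀ n, ∫ x, (F n x) ^ 2 ∂μ ≤ ∫ x, (u x) ^ 2 ∂μ := by
  have hA := flipAvg_memLp hθμ hu hF0 hFs
  intro n
  induction n with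
  | zero => exact le_of_eq (integral_congr_ae (ae_of_all _ fun x => by simp only [hF0 x]))
  | succ n ih =>
    have h1 : Integrable (fun x => (F (n + 1) x) ^ 2) μ := (hA (n + 1)).integrable_sq
    have h2 : Integrable (fun x => (F n x) ^ 2) μ := (hA n).integrable_sq
    have h3 : Integrable (fun x => (F n (θ n x)) ^ 2) μ :=
      ((hθμ n).integrable_comp_emb (measurableEmbedding_of_involutive (hθi n) (hθμ n).measurable)).mpr h2
    have h4 : Integrable (fun x => ((F n x) ^ 2 + (F n (θ n x)) ^ 2) / 2) μ := (h2.add h3).div_const 2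
    have hpt : ∀ x, (F (n + 1) x) ^ 2 ≤ ((F n x) ^ 2 + (F n (θ n x)) ^ 2) / 2 := by
      intro x
      rw [hFs n x]
      nlinarith [sq_nonneg (F n x - F n (θ n x))]
    calc ∫ x, (F (n + 1) x) ^ 2 ∂μ ≤ ∫ x, ((F n x) ^ 2 + (F n (θ n x)) ^ 2) / 2 ∂μ :=
          integral_mono h1 h4 hpt
      _ = (∫ x, (F n x) ^ 2 ∂μ + ∫ x, (F n (θ n x)) ^ 2 ∂μ) / 2 := by
          rw [integral_div, integral_add h2 h3]
      _ = ∫ x, (F n x) ^ 2 ∂μ := by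
          rw [integral_comp_of_involutive (hθμ n) (hθi n) (fun x => (F n x) ^ 2)]
          ring
      _ ≤ ∫ x, (u x) ^ 2 ∂μ := ih

/-- Orthogonality of the telescoping: `u - F_n` is `L²(μ)`-orthogonal to every `L²` function that is
`θ_k`-even for all `k < n` (the increments `F_k - F_{k+1} = (F_k - F_k ∘ θ_k)/2` are `θ_k`-odd). [folklore] -/
theorem flipAvg_orth (hθμ : ∀ k, MeasurePreserving (θ k) μ μ) (hθi : ∀ k, Function.Involutive (θ k))
    (hu : MemLp u 2 μ) (hF0 : ∀ x, F 0 x = u x)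
    (hFs : ∀ k x, F (k + 1) x = (F k x + F k (θ k x)) / 2) :
    ∀ n (g : X → ℝ), MemLp g 2 μ → (∀ k, k < n → ∀ x, g (θ k x) = g x) →
      ∫ x, (u x - F n x) * g x ∂μ = 0 := by
  have hA := flipAvg_memLp hθμ hu hF0 hFs
  intro n
  induction n with
  | zero => intro g _ _; simp [hF0]
  | succ n ih =>
    intro g hg hge
    have i1 : Integrable (fun x => (u x - F n x) * g x) μ := (hu.sub (hA n)).integrable_mul hg
    have i2 : Integrable (fun x => 1 / 2 * (F n x * g x)) μ := ((hA n).integrable_mul hg).const_mul _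
    have i3 : Integrable (fun x => 1 / 2 * (F n (θ n x) * g x)) μ :=
      (((hA n).comp_measurePreserving (hθμ n)).integrable_mul hg).const_mul _
    have i12 : Integrable (fun x => (u x - F n x) * g x + 1 / 2 * (F n x * g x)) μ := i1.add i2
    have hcv : ∫ x, F n (θ n x) * g x ∂μ = ∫ x, F n x * g x ∂μ := by
      calc ∫ x, F n (θ n x) * g x ∂μ = ∫ x, F n (θ n x) * g (θ n x) ∂μ :=
            integral_congr_ae (ae_of_all _ fun x => by
              show F n (θ n x) * g x = F n (θ n x) * g (θ n x)
              rw [hge n (lt_add_one n) x])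
        _ = ∫ x, F n x * g x ∂μ := integral_comp_of_involutive (hθμ n) (hθi n) (fun x => F n x * g x)
    have hpt : (fun x => (u x - F (n + 1) x) * g x) =
        fun x => (u x - F n x) * g x + 1 / 2 * (F n x * g x) - 1 / 2 * (F n (θ n x) * g x) := by
      funext x
      rw [hFs n x]
      ring
    rw [hpt, integral_sub i12 i3, integral_add i1 i2, integral_const_mul, integral_const_mul, hcv,
      ih g hg (fun k hk => hge k (Nat.lt_succ_of_lt hk))]
    ring

/-- **Abstract flip sector gap.** For pairwise commuting `μ`-preserving involutions `θ_k` and `u ∈ L²(μ)`,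
the iterated averages satisfy `4 ∫ (u - F_n)² dμ ≤ ∑_{k<n} ∫ (u ∘ θ_k - u)² dμ`. [folklore] -/
theorem flipAvg_gap (hθμ : ∀ k, MeasurePreserving (θ k) μ μ) (hθi : ∀ k, Function.Involutive (θ k))
    (hθc : ∀ j k x, θ j (θ k x) = θ k (θ j x)) (hu : MemLp u 2 μ) (hF0 : ∀ x, F 0 x = u x)
    (hFs : ∀ k x, F (k + 1) x = (F k x + F k (θ k x)) / 2) :
    ∀ n, 4 * ∫ x, (u x - F n x) ^ 2 ∂μ ≤ ∑ k ∈ Finset.range n, ∫ x, (u (θ k x) - u x) ^ 2 ∂μ := by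
  have hA := flipAvg_memLp hθμ hu hF0 hFs
  intro n
  induction n with
  | zero => simp [hF0]
  | succ n ih =>
    -- the increment `D_n = (F_n - F_n ∘ θ_n)/2`
    have hD : MemLp (fun x => (F n x - F n (θ n x)) / 2) 2 μ := by
      have h := ((hA n).sub ((hA n).comp_measurePreserving (hθμ n))).mul_const (2⁻¹ : ℝ)
      exact h.ae_eq (ae_of_all _ fun x => by
        simp only [Pi.sub_apply, Function.comp_apply, div_eq_mul_inv])
    have hDeven : ∀ k, k < n → ∀ x,
        (F n (θ k x) - F n (θ n (θ k x))) / 2 = (F n x - F n (θ n x)) / 2 := by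
      intro k hk x
      rw [flipAvg_even hθi hθc hFs n k hk x, hθc n k x, flipAvg_even hθi hθc hFs n k hk (θ n x)]
    have horth : ∫ x, (u x - F n x) * ((F n x - F n (θ n x)) / 2) ∂μ = 0 :=
      flipAvg_orth hθμ hθi hu hF0 hFs n (fun x => (F n x - F n (θ n x)) / 2) hD hDeven
    -- `k ↦ F_k - F_k ∘ θ_n` is the averaging scheme started from `u - u ∘ θ_n`
    have hu' : MemLp (fun x => u x - u (θ n x)) 2 μ := hu.sub (hu.comp_measurePreserving (hθμ n))
    have hGle : ∫ x, (F n x - F n (θ n x)) ^ 2 ∂μ ≤ ∫ x, (u x - u (θ n x)) ^ 2 ∂μ :=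
      flipAvg_integral_sq_le (F := fun k x => F k x - F k (θ n x)) hθμ hθi hu'
        (fun x => by simp only [hF0]) (flipAvg_sub_comp (fun k x => hθc k n x) hFs) n
    have hsym : ∫ x, (u x - u (θ n x)) ^ 2 ∂μ = ∫ x, (u (θ n x) - u x) ^ 2 ∂μ :=
      integral_congr_ae (ae_of_all _ fun x => by ring)
    -- expand the square
    have i1 : Integrable (fun x => (u x - F n x) ^ 2) μ := (hu.sub (hA n)).integrable_sq
    have i2 : Integrable (fun x => ((F n x - F n (θ n x)) / 2) ^ 2) μ := hD.integrable_sq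
    have i3 : Integrable (fun x => 2 * ((u x - F n x) * ((F n x - F n (θ n x)) / 2))) μ :=
      ((hu.sub (hA n)).integrable_mul hD).const_mul 2
    have i12 : Integrable (fun x => (u x - F n x) ^ 2 + ((F n x - F n (θ n x)) / 2) ^ 2) μ := i1.add i2
    have hpt : (fun x => (u x - F (n + 1) x) ^ 2) = fun x =>
        (u x - F n x) ^ 2 + ((F n x - F n (θ n x)) / 2) ^ 2 +
          2 * ((u x - F n x) * ((F n x - F n (θ n x)) / 2)) := by
      funext x
      rw [hFs n x]
      ring
    have hsq : ∫ x, ((F n x - F n (θ n x)) / 2) ^ 2 ∂μ = (∫ x, (F n x - F n (θ n x)) ^ 2 ∂μ) / 4 := by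
      rw [← integral_div]
      exact integral_congr_ae (ae_of_all _ fun x => by ring)
    rw [hpt, integral_add i12 i3, integral_add i1 i2, integral_const_mul, horth, hsq,
      Finset.sum_range_succ]
    linarith

end Abstract

/-! ### The momentum flips of phase space as a commuting family of involutions -/

variable {L : ℕ}

/-- Single-site momentum flips commute. [folklore] -/
-- adapted from `NonBallistic.momentumFlip_comm` (JunctionLocalityNonBallisticStubLightConeWindowAux1)
theorem momentumFlip_comm (i j : Fin L) (x : PhaseSpace L) :
    momentumFlip i (momentumFlip j x) = momentumFlip j (momentumFlip i x) := by
  by_cases hij : i = j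
  · subst hij
    rfl
  refine Prod.ext rfl (funext fun k => ?_)
  by_cases hki : k = i
  · subst hki
    rw [momentumFlip_snd_self, momentumFlip_snd_of_ne hij, momentumFlip_snd_of_ne hij,
      momentumFlip_snd_self]
  · by_cases hkj : k = j
    · subst hkj
      rw [momentumFlip_snd_of_ne hki, momentumFlip_snd_self, momentumFlip_snd_self,
        momentumFlip_snd_of_ne hki]
    · rw [momentumFlip_snd_of_ne hki, momentumFlip_snd_of_ne hkj, momentumFlip_snd_of_ne hkj,
        momentumFlip_snd_of_ne hki]

/-- The flips `θ_k = momentumFlip k` (`k < L`), continued by the identity for `k ≥ L`, form an `ℕ`-indexed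
family of pairwise commuting involutions preserving every flip-invariant measure. [folklore] -/
theorem exists_natFlip (L : ℕ) (μ : Measure (PhaseSpace L))
    (hμ : ∀ i : Fin L, MeasurePreserving (momentumFlip i) μ μ) :
    ∃ θ : ℕ → PhaseSpace L → PhaseSpace L, (∀ i : Fin L, θ i = momentumFlip i) ∧
      (∀ k, MeasurePreserving (θ k) μ μ) ∧ (∀ k, Function.Involutive (θ k)) ∧
      (∀ j k x, θ j (θ k x) = θ k (θ j x)) := by
  let θ : ℕ → PhaseSpace L → PhaseSpace L := fun k => if h : k < L then momentumFlip ⟨k, h⟩ else id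
  have hlt : ∀ k (h : k < L), θ k = momentumFlip ⟨k, h⟩ := fun k h => dif_pos h
  have hge : ∀ k, ¬ k < L → θ k = id := fun k h => dif_neg h
  refine ⟨θ, fun i => hlt i i.isLt, fun k => ?_, fun k => ?_, fun j k x => ?_⟩
  · by_cases h : k < L
    · rw [hlt k h]; exact hμ _
    · rw [hge k h]; exact MeasurePreserving.id μ
  · by_cases h : k < L
    · rw [hlt k h]; exact momentumFlip_involutive _
    · rw [hge k h]; exact fun _ => rfl
  · by_cases hj : j < L
    · by_cases hk : k < L
      · rw [hlt j hj, hlt k hk]; exact momentumFlip_comm _ _ x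
      · rw [hge k hk]; rfl
    · rw [hge j hj]; rfl

/-! ### The `L`-th iterated average is the average over all sign patterns -/

/-- Reindexing step: summing `u ∘ σ_w` over the sign patterns `w` truncated to the first `k` momenta, at `x`
and at `θ_k x`, gives twice the sum over the patterns truncated to the first `k + 1` momenta (pair `w` with
`w[k ↦ ¬ w_k]`). [folklore] -/
theorem sum_pattern_succ (u : PhaseSpace L → ℝ) (k : ℕ) (hk : k < L) (x : PhaseSpace L) :
    ∑ w : Fin L → Bool, u (x.1, fun i => if (w i && decide (i.val < k)) then -x.2 i else x.2 i) +
      ∑ w : Fin L → Bool, u ((momentumFlip ⟨k, hk⟩ x).1, fun i =>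
        if (w i && decide (i.val < k)) then -(momentumFlip ⟨k, hk⟩ x).2 i else (momentumFlip ⟨k, hk⟩ x).2 i) =
      2 * ∑ w : Fin L → Bool, u (x.1, fun i => if (w i && decide (i.val < k + 1)) then -x.2 i else x.2 i) := by
  set kk : Fin L := ⟨k, hk⟩
  -- the pattern truncated to `k + 1` momenta, according to its `k`-th bit
  have P1 : ∀ w : Fin L → Bool,
      ((x.1, fun i => if (w i && decide (i.val < k + 1)) then -x.2 i else x.2 i) : PhaseSpace L) =
        if w kk then ((momentumFlip kk x).1, fun i =>
          if (w i && decide (i.val < k)) then -(momentumFlip kk x).2 i else (momentumFlip kk x).2 i)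
        else (x.1, fun i => if (w i && decide (i.val < k)) then -x.2 i else x.2 i) := by
    intro w
    have hkval : (kk : ℕ) = k := rfl
    split_ifs with hw
    · refine Prod.ext (momentumFlip_fst kk x).symm (funext fun i => ?_)
      dsimp only
      by_cases hi : i = kk
      · rw [hi, momentumFlip_snd_self]
        simp [hw, hkval]
      · have hik : i.val ≠ k := fun h => hi (Fin.ext h)
        rw [momentumFlip_snd_of_ne hi]
        by_cases hlt : i.val < k
        · simp [hlt, Nat.lt_succ_of_lt hlt]
        · have hnlt : ¬ i.val < k + 1 := by omega
          simp [hlt, hnlt]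
    · refine Prod.ext rfl (funext fun i => ?_)
      dsimp only
      by_cases hi : i = kk
      · rw [hi]
        simp [hw, hkval]
      · have hik : i.val ≠ k := fun h => hi (Fin.ext h)
        by_cases hlt : i.val < k
        · simp [hlt, Nat.lt_succ_of_lt hlt]
        · have hnlt : ¬ i.val < k + 1 := by omega
          simp [hlt, hnlt]
  -- the reindexing involution `w ↦ w[k ↦ ¬ w_k]` does not change the truncation to `k` momenta
  have P2 : ∀ (w : Fin L → Bool) (i : Fin L),
      (Function.update w kk (!w kk) i && decide (i.val < k)) = (w i && decide (i.val < k)) := by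
    intro w i
    by_cases hi : i = kk
    · rw [hi, Function.update_self]
      simp [show (kk : ℕ) = k from rfl]
    · rw [Function.update_of_ne hi]
  have hφ : Function.Involutive (fun w : Fin L → Bool => Function.update w kk (!w kk)) := by
    intro w
    simp
  set f : (Fin L → Bool) → ℝ :=
    fun w => u (x.1, fun i => if (w i && decide (i.val < k + 1)) then -x.2 i else x.2 i) with hf
  have hre : ∑ w : Fin L → Bool, f (Function.update w kk (!w kk)) = ∑ w, f w := by
    have h := Equiv.sum_comp (Function.Involutive.toPerm _ hφ) f
    simpa only [Function.Involutive.coe_toPerm] using h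
  have hpair : ∀ w : Fin L → Bool,
      u (x.1, fun i => if (w i && decide (i.val < k)) then -x.2 i else x.2 i) +
        u ((momentumFlip kk x).1, fun i =>
          if (w i && decide (i.val < k)) then -(momentumFlip kk x).2 i else (momentumFlip kk x).2 i) =
        f w + f (Function.update w kk (!w kk)) := by
    intro w
    simp only [hf, P1, P2, Function.update_self]
    cases w kk <;> simp [add_comm]
  calc ∑ w : Fin L → Bool, u (x.1, fun i => if (w i && decide (i.val < k)) then -x.2 i else x.2 i) +
        ∑ w : Fin L → Bool, u ((momentumFlip kk x).1, fun i =>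
          if (w i && decide (i.val < k)) then -(momentumFlip kk x).2 i else (momentumFlip kk x).2 i)
        = ∑ w : Fin L → Bool, (f w + f (Function.update w kk (!w kk))) := by
          rw [← Finset.sum_add_distrib]
          exact Finset.sum_congr rfl fun w _ => hpair w
    _ = 2 * ∑ w, f w := by rw [Finset.sum_add_distrib, hre, two_mul]

/-- Closed form of the iterated flip averages on phase space: for `k ≤ L`, `F_k(x)` is `2^{-L}` times the sum
of `u ∘ σ_w (x)` over all sign patterns `w ∈ {0,1}^L` truncated to the first `k` momenta. [folklore] -/
theorem flipAvg_closed_form (u : PhaseSpace L → ℝ) {θ : ℕ → PhaseSpace L → PhaseSpace L}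
    (hθ : ∀ i : Fin L, θ i = momentumFlip i) {F : ℕ → PhaseSpace L → ℝ} (hF0 : ∀ x, F 0 x = u x)
    (hFs : ∀ k x, F (k + 1) x = (F k x + F k (θ k x)) / 2) :
    ∀ k, k ≤ L → ∀ x, F k x =
      (∑ w : Fin L → Bool, u (x.1, fun i => if (w i && decide (i.val < k)) then -x.2 i else x.2 i)) / 2 ^ L := by
  intro k
  induction k with
  | zero =>
    intro _ x
    have hw : ∀ w : Fin L → Bool,
        u (x.1, fun i => if (w i && decide (i.val < 0)) then -x.2 i else x.2 i) = u x := by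
      intro w
      simp
    simp only [hF0 x, hw, Finset.sum_const, Finset.card_univ, Fintype.card_fun, Fintype.card_bool,
      Fintype.card_fin, nsmul_eq_mul, Nat.cast_pow, Nat.cast_ofNat]
    field_simp
  | succ k ih =>
    intro hk x
    have hkL : k < L := hk
    have hθk : θ k = momentumFlip ⟨k, hkL⟩ := hθ ⟨k, hkL⟩
    rw [hFs k x, ih hkL.le x, ih hkL.le (θ k x), hθk, ← add_div, sum_pattern_succ u k hkL x]
    ring

/-- At `k = L` the iterated flip average is the full pattern average `P₀ u = 2^{-L} ∑_w u ∘ σ_w`. [folklore] -/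
theorem flipAvg_closed_form_top (u : PhaseSpace L → ℝ) {θ : ℕ → PhaseSpace L → PhaseSpace L}
    (hθ : ∀ i : Fin L, θ i = momentumFlip i) {F : ℕ → PhaseSpace L → ℝ} (hF0 : ∀ x, F 0 x = u x)
    (hFs : ∀ k x, F (k + 1) x = (F k x + F k (θ k x)) / 2) (x : PhaseSpace L) :
    F L x = (∑ w : Fin L → Bool, u (x.1, fun i => if w i then -x.2 i else x.2 i)) / 2 ^ L := by
  rw [flipAvg_closed_form u hθ hF0 hFs L le_rfl x]
  congr 1
  refine Finset.sum_congr rfl fun w _ => ?_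
  congr 2
  funext i
  simp [i.isLt]

/-! ### The registered stub -/

/-- **Flip sector gap (hypercube Poincaré inequality), stub `stub_flipSectorGap`** of line
`abel-kapitza-even-corrector` (crux stmt-AtomisticToContinuum-11977): in `L²` of any measure on phase space
invariant under every single-site momentum flip `θ_i`, `4 ∫ (u − P₀u)² dμ ≤ Σ_i ∫ (u ∘ θ_i − u)² dμ`, where
`P₀ u` is the average of `u` over the `2^L` momentum sign patterns. [folklore] -/
theorem stub_flipSectorGap :
    ∀ (L : ℕ) (μ : MeasureTheory.Measure (Literature.MathematicalPhysics.KineticTheory.HeatConduction.PhaseSpace L)), (∀ i : Fin L, MeasureTheory.MeasurePreserving (Literature.MathematicalPhysics.KineticTheory.HeatConduction.momentumFlip i) μ μ) → ∀ u : Literature.MathematicalPhysics.KineticTheory.HeatConduction.PhaseSpace L → ℝ, MeasureTheory.MemLp u 2 μ → 4 * MeasureTheory.integral μ (fun x => (u x - (∑ w : Fin L → Bool, u (x.1, fun i => if w i then -x.2 i else x.2 i)) / 2 ^ L) ^ 2) ≤ ∑ i : Fin L, MeasureTheory.integral μ (fun x => (u (Literature.MathematicalPhysics.KineticTheory.HeatConduction.momentumFlip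 i x) - u x) ^ 2) := by
  intro L μ hμ u hu
  obtain ⟨θ, hθfin, hθμ, hθi, hθc⟩ := exists_natFlip L μ hμ
  obtain ⟨F, hF0, hFs⟩ : ∃ F : ℕ → PhaseSpace L → ℝ,
      (∀ x, F 0 x = u x) ∧ ∀ k x, F (k + 1) x = (F k x + F k (θ k x)) / 2 :=
    ⟨fun n => Nat.rec u (fun k Fk x => (Fk x + Fk (θ k x)) / 2) n, fun _ => rfl, fun _ _ => rfl⟩
  have hlhs : (fun x => (u x - (∑ w : Fin L → Bool, u (x.1, fun i => if w i then -x.2 i else x.2 i)) / 2 ^ L) ^ 2) =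
      fun x => (u x - F L x) ^ 2 := by
    funext x
    rw [flipAvg_closed_form_top u hθfin hF0 hFs x]
  have hrhs : ∑ k ∈ Finset.range L, ∫ x, (u (θ k x) - u x) ^ 2 ∂μ =
      ∑ i : Fin L, ∫ x, (u (momentumFlip i x) - u x) ^ 2 ∂μ := by
    rw [← Fin.sum_univ_eq_sum_range (fun k => ∫ x, (u (θ k x) - u x) ^ 2 ∂μ) L]
    exact Finset.sum_congr rfl fun i _ => by rw [hθfin i]
  rw [hlhs, ← hrhs]
  exact flipAvg_gap hθμ hθi hθc hu hF0 hFs L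

end Summit.AtomisticToContinuum.FouriersLaw.Cruxes.NoisyFourier.AbelKapitzaEvenCorrector

end
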